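import Mathlib
import Summits.Ventures.PercRepro2.Defs
import Summits.Ventures.PercRepro2.Independence
import Summits.Ventures.PercRepro2.Harris
import Summits.Ventures.PercRepro2.Graph
import Summits.Ventures.PercRepro2.Exploration
import Summits.Ventures.PercRepro2.Events
import Summits.Ventures.PercRepro2.Induced
import Summits.Ventures.PercRepro2.SeedSet
import Summits.Ventures.PercRepro2.MultiSourceFun
import Summits.Ventures.PercRepro2.CrossRootT
import Summits.Ventures.PercRepro2.RBDefs
import Summits.Ventures.PercRepro2.RBChain
import Summits.Ventures.PercRepro2.RBTransport
import Summits.Ventures.PercRepro2.RBTransportZero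

/-!
# The transport for the same-cluster form (RB-same) (blind cell PercRepro2, typer-1; mine-a §8
"(or Y = {o ↔ s} for the same-cluster form)")

Same three kinds of atoms, reversed inequality: the 0-step atoms are EQUALITIES
(`atomEq_of_subset_X`, `atomEq_of_disjoint_X`, `atomEq_of_const_τ` — the equality forms of the
`RBTransportZero` lemmas; for `Y = {o ↔ s}`, `s ∈ A_w` makes `X` constant and `o ∈ A_w` with `s ∉ H(x)`
makes `Y` impossible), and on a hole atom `RBsame (pinSet p H(x))` transports (`atom_step_same`).

* **`RBsameOn_of_RBsame_all`** and **`covRevealed_le_insert_of_RB_all`**: with `RB_all`,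
  `Cov_{𝓖_{W ∪ {w′}}} ≥ Cov_{𝓖_W}` for the same-cluster pair `X = {b ↔ s}`, `Y = {o ↔ s}`.
-/

namespace Summit.Ventures.PercRepro2

namespace RB

open scoped Classical

variable {V : Type*} {E : Type*} [Fintype E] [DecidableEq E] [Fintype V] [DecidableEq V]
  {R : Type*} [Field R] [LinearOrder R] [IsStrictOrderedRing R]

section Eq

variable (p : E → R) (ends : E → Sym2 V) (s t : V)

/-- The two sides of the atom inequality. -/
noncomputable def atomLHS {α β : Type*} [Fintype β] (σ : Config E → α) (τ : Config E → β)
    (X Y : Set (Config E)) (x : α) : R :=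
  ∑ y : β, prob p (Qst ends s t ∩ {ω | σ ω = x} ∩ {ω | τ ω = y} ∩ X) *
      prob p (Qst ends s t ∩ {ω | σ ω = x} ∩ {ω | τ ω = y} ∩ Y) /
    prob p (Qst ends s t ∩ {ω | σ ω = x} ∩ {ω | τ ω = y})

/-- The right-hand side of the atom inequality. -/
noncomputable def atomRHS {α : Type*} (σ : Config E → α) (X Y : Set (Config E)) (x : α) : R :=
  prob p (Qst ends s t ∩ {ω | σ ω = x} ∩ X) * prob p (Qst ends s t ∩ {ω | σ ω = x} ∩ Y) /
    prob p (Qst ends s t ∩ {ω | σ ω = x})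

omit [DecidableEq V] [Fintype V] in
/-- Equality when `X` is sure on the atom (both `≤` and `≥` from the two symmetric lemmas). -/
lemma atomEq_of_subset_X (hp : IsProbVec p) {α β : Type*} [Fintype β] (σ : Config E → α)
    (τ : Config E → β) (X Y : Set (Config E)) (x : α) (hX : Qst ends s t ∩ {ω | σ ω = x} ⊆ X) :
    atomRHS p ends s t σ X Y x ≤ atomLHS p ends s t σ τ X Y x := by
  unfold atomLHS atomRHS
  have hterm : ∀ y : β,
      prob p (Qst ends s t ∩ {ω | σ ω = x} ∩ {ω | τ ω = y} ∩ X) *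
          prob p (Qst ends s t ∩ {ω | σ ω = x} ∩ {ω | τ ω = y} ∩ Y) /
        prob p (Qst ends s t ∩ {ω | σ ω = x} ∩ {ω | τ ω = y}) =
      prob p (Qst ends s t ∩ {ω | σ ω = x} ∩ Y ∩ {ω | τ ω = y}) := by
    intro y
    have e1 : Qst ends s t ∩ {ω | σ ω = x} ∩ {ω | τ ω = y} ∩ X =
        Qst ends s t ∩ {ω | σ ω = x} ∩ {ω | τ ω = y} := by
      ext ω
      simp only [Set.mem_inter_iff]
      exact ⟨fun h => h.1, fun h => ⟨h, hX ⟨h.1.1, h.1.2⟩⟩⟩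
    have e2 : Qst ends s t ∩ {ω | σ ω = x} ∩ {ω | τ ω = y} ∩ Y =
        Qst ends s t ∩ {ω | σ ω = x} ∩ Y ∩ {ω | τ ω = y} := by
      ext ω; simp only [Set.mem_inter_iff]; tauto
    rw [e1, e2]
    exact mul_div_self_of_le (prob_mono hp (by
      rintro ω ⟨⟨hq, _⟩, hy⟩; exact ⟨hq, hy⟩)) (prob_nonneg hp _)
  simp_rw [hterm]
  rw [sum_prob_inter_state]
  have e3 : Qst ends s t ∩ {ω | σ ω = x} ∩ X = Qst ends s t ∩ {ω | σ ω = x} := by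
    ext ω
    simp only [Set.mem_inter_iff]
    exact ⟨fun h => h.1, fun h => ⟨h, hX h⟩⟩
  rw [e3]
  exact le_of_eq (mul_div_self_of_le (prob_mono hp Set.inter_subset_left) (prob_nonneg hp _))

omit [DecidableEq V] [Fintype V] [IsStrictOrderedRing R] in
/-- Both sides vanish when `X` is impossible on the atom. -/
lemma atomEq_of_disjoint_X {α β : Type*} [Fintype β] (σ : Config E → α) (τ : Config E → β)
    (X Y : Set (Config E)) (x : α) (hX : Qst ends s t ∩ {ω | σ ω = x} ∩ X = ∅) :
    atomRHS p ends s t σ X Y x ≤ atomLHS p ends s t σ τ X Y x := by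
  unfold atomLHS atomRHS
  have hterm : ∀ y : β,
      prob p (Qst ends s t ∩ {ω | σ ω = x} ∩ {ω | τ ω = y} ∩ X) *
          prob p (Qst ends s t ∩ {ω | σ ω = x} ∩ {ω | τ ω = y} ∩ Y) /
        prob p (Qst ends s t ∩ {ω | σ ω = x} ∩ {ω | τ ω = y}) = 0 := by
    intro y
    have e : Qst ends s t ∩ {ω | σ ω = x} ∩ {ω | τ ω = y} ∩ X = ∅ := by
      rw [Set.eq_empty_iff_forall_notMem] at hX ⊢
      rintro ω ⟨⟨⟨hq, hx⟩, _⟩, hX'⟩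
      exact hX ω ⟨⟨hq, hx⟩, hX'⟩
    rw [e, prob_empty, zero_mul, zero_div]
  simp_rw [hterm]
  rw [Finset.sum_const_zero, hX, prob_empty, zero_mul, zero_div]

omit [DecidableEq V] [Fintype V] [IsStrictOrderedRing R] in
/-- Both sides vanish when `Y` is impossible on the atom. -/
lemma atomEq_of_disjoint_Y {α β : Type*} [Fintype β] (σ : Config E → α) (τ : Config E → β)
    (X Y : Set (Config E)) (x : α) (hY : Qst ends s t ∩ {ω | σ ω = x} ∩ Y = ∅) :
    atomRHS p ends s t σ X Y x ≤ atomLHS p ends s t σ τ X Y x := by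
  unfold atomLHS atomRHS
  have hterm : ∀ y : β,
      prob p (Qst ends s t ∩ {ω | σ ω = x} ∩ {ω | τ ω = y} ∩ X) *
          prob p (Qst ends s t ∩ {ω | σ ω = x} ∩ {ω | τ ω = y} ∩ Y) /
        prob p (Qst ends s t ∩ {ω | σ ω = x} ∩ {ω | τ ω = y}) = 0 := by
    intro y
    have e : Qst ends s t ∩ {ω | σ ω = x} ∩ {ω | τ ω = y} ∩ Y = ∅ := by
      rw [Set.eq_empty_iff_forall_notMem] at hY ⊢
      rintro ω ⟨⟨⟨hq, hx⟩, _⟩, hY'⟩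
      exact hY ω ⟨⟨hq, hx⟩, hY'⟩
    rw [e, prob_empty, mul_zero, zero_div]
  simp_rw [hterm]
  rw [Finset.sum_const_zero, hY, prob_empty, mul_zero, zero_div]

omit [DecidableEq V] [Fintype V] [IsStrictOrderedRing R] in
/-- Equality when `τ` is constant on the atom. -/
lemma atomEq_of_const_τ {α β : Type*} [Fintype β] (σ : Config E → α) (τ : Config E → β)
    (X Y : Set (Config E)) (x : α) (y₀ : β) (hτ : Qst ends s t ∩ {ω | σ ω = x} ⊆ {ω | τ ω = y₀}) :
    atomRHS p ends s t σ X Y x ≤ atomLHS p ends s t σ τ X Y x := by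
  unfold atomLHS atomRHS
  rw [Finset.sum_eq_single y₀]
  · have e : Qst ends s t ∩ {ω | σ ω = x} ∩ {ω | τ ω = y₀} = Qst ends s t ∩ {ω | σ ω = x} := by
      ext ω
      simp only [Set.mem_inter_iff]
      exact ⟨fun h => h.1, fun h => ⟨h, hτ h⟩⟩
    rw [e]
  · intro y _ hy
    have e : Qst ends s t ∩ {ω | σ ω = x} ∩ {ω | τ ω = y} = ∅ := by
      rw [Set.eq_empty_iff_forall_notMem]
      rintro ω ⟨hq, hy'⟩
      exact hy (hy'.symm.trans (hτ hq))
    have e1 : Qst ends s t ∩ {ω | σ ω = x} ∩ {ω | τ ω = y} ∩ X = ∅ := by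
      rw [e, Set.empty_inter]
    rw [e1, prob_empty, zero_mul, zero_div]
  · intro h; exact absurd (Finset.mem_univ _) h

end Eq

section Same

variable (p : E → R) (ends : E → Sym2 V) (W : Finset V) (o b s t w' : V) (x : ↥W → Set V)

omit [Fintype E] [DecidableEq E] [Fintype V] [DecidableEq V] in
/-- The hole identities for the same-cluster pair (`Y = {o ↔ s}`). -/
lemma hole_event_eq_same (hs : s ∉ revHull W x) (hb : b ∉ revHull W x) (ho : o ∉ revHull W x)
    (hw : w' ∉ revHull W x) (y : Set V) :
    (Qst ends s t ∩ atom ends W x ∩ {ω | cluster ends ω w' = y} ∩ connEvent ends b s =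
        atom ends W x ∩ {ω | delConfig ends (revHull W x) ω ∈
          Qst ends s t ∩ {ω | cluster ends ω w' = y} ∩ connEvent ends b s}) ∧
      (Qst ends s t ∩ atom ends W x ∩ {ω | cluster ends ω w' = y} ∩ connEvent ends o s =
        atom ends W x ∩ {ω | delConfig ends (revHull W x) ω ∈
          Qst ends s t ∩ {ω | cluster ends ω w' = y} ∩ connEvent ends o s}) ∧
      (Qst ends s t ∩ atom ends W x ∩ {ω | cluster ends ω w' = y} =
        atom ends W x ∩ {ω | delConfig ends (revHull W x) ω ∈
          Qst ends s t ∩ {ω | cluster ends ω w' = y}}) ∧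
      (Qst ends s t ∩ atom ends W x ∩ connEvent ends b s =
        atom ends W x ∩ {ω | delConfig ends (revHull W x) ω ∈ Qst ends s t ∩ connEvent ends b s}) ∧
      (Qst ends s t ∩ atom ends W x ∩ connEvent ends o s =
        atom ends W x ∩ {ω | delConfig ends (revHull W x) ω ∈ Qst ends s t ∩ connEvent ends o s}) ∧
      (Qst ends s t ∩ atom ends W x =
        atom ends W x ∩ {ω | delConfig ends (revHull W x) ω ∈ Qst ends s t}) := by
  have hQ : ∀ ω ∈ atom ends W x,
      (ω ∈ Qst ends s t ↔ delConfig ends (revHull W x) ω ∈ Qst ends s t) := by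
    intro ω hω
    simp only [Qst, connEvent, Set.mem_compl_iff, Set.mem_setOf_eq]
    rw [conn_iff_del_of_atom ends W hω hs]
  have hX : ∀ ω ∈ atom ends W x,
      (ω ∈ connEvent ends b s ↔ delConfig ends (revHull W x) ω ∈ connEvent ends b s) := by
    intro ω hω
    simp only [connEvent, Set.mem_setOf_eq]
    rw [conn_iff_del_of_atom ends W hω hb]
  have hY : ∀ ω ∈ atom ends W x,
      (ω ∈ connEvent ends o s ↔ delConfig ends (revHull W x) ω ∈ connEvent ends o s) := by
    intro ω hω
    simp only [connEvent, Set.mem_setOf_eq]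
    rw [conn_iff_del_of_atom ends W hω ho]
  have hC : ∀ ω ∈ atom ends W x, (ω ∈ {ω | cluster ends ω w' = y} ↔
      delConfig ends (revHull W x) ω ∈ {ω | cluster ends ω w' = y}) := by
    intro ω hω
    simp only [Set.mem_setOf_eq]
    rw [cluster_eq_del_of_atom ends W hω hw]
  refine ⟨?_, ?_, ?_, ?_, ?_, ?_⟩ <;> ext ω <;>
    simp only [Set.mem_inter_iff, Set.mem_setOf_eq] <;>
    constructor
  · rintro ⟨⟨⟨hq, hA⟩, hc⟩, hx⟩
    exact ⟨hA, ⟨(hQ ω hA).1 hq, (hC ω hA).1 hc⟩, (hX ω hA).1 hx⟩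
  · rintro ⟨hA, ⟨hq, hc⟩, hx⟩
    exact ⟨⟨⟨(hQ ω hA).2 hq, hA⟩, (hC ω hA).2 hc⟩, (hX ω hA).2 hx⟩
  · rintro ⟨⟨⟨hq, hA⟩, hc⟩, hy⟩
    exact ⟨hA, ⟨(hQ ω hA).1 hq, (hC ω hA).1 hc⟩, (hY ω hA).1 hy⟩
  · rintro ⟨hA, ⟨hq, hc⟩, hy⟩
    exact ⟨⟨⟨(hQ ω hA).2 hq, hA⟩, (hC ω hA).2 hc⟩, (hY ω hA).2 hy⟩
  · rintro ⟨⟨hq, hA⟩, hc⟩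
    exact ⟨hA, (hQ ω hA).1 hq, (hC ω hA).1 hc⟩
  · rintro ⟨hA, hq, hc⟩
    exact ⟨⟨(hQ ω hA).2 hq, hA⟩, (hC ω hA).2 hc⟩
  · rintro ⟨⟨hq, hA⟩, hx⟩
    exact ⟨hA, (hQ ω hA).1 hq, (hX ω hA).1 hx⟩
  · rintro ⟨hA, hq, hx⟩
    exact ⟨⟨(hQ ω hA).2 hq, hA⟩, (hX ω hA).2 hx⟩
  · rintro ⟨⟨hq, hA⟩, hy⟩
    exact ⟨hA, (hQ ω hA).1 hq, (hY ω hA).1 hy⟩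
  · rintro ⟨hA, hq, hy⟩
    exact ⟨⟨(hQ ω hA).2 hq, hA⟩, (hY ω hA).2 hy⟩
  · rintro ⟨hq, hA⟩
    exact ⟨hA, (hQ ω hA).1 hq⟩
  · rintro ⟨hA, hq⟩
    exact ⟨(hQ ω hA).2 hq, hA⟩

/-- **The hole transport, same-cluster form**. -/
theorem atom_step_same_of_RBsame (hp : IsProbVec p) (hs : s ∉ revHull W x)
    (hb : b ∉ revHull W x) (ho : o ∉ revHull W x) (hw : w' ∉ revHull W x)
    (hRB : RBsame (pinSet p ends (revHull W x)) ends o b s t w') :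
    atomRHS p ends s t (revealState ends W) (connEvent ends b s) (connEvent ends o s) x ≤
      atomLHS p ends s t (revealState ends W) (fun ω => cluster ends ω w') (connEvent ends b s)
        (connEvent ends o s) x := by
  unfold atomLHS atomRHS
  have hA0 : 0 ≤ prob p (atom ends W x) := prob_nonneg hp _
  set q := pinSet p ends (revHull W x) with hq
  set pa := prob p (atom ends W x) with hpa
  have hterm : ∀ y : Set V,
      prob p (Qst ends s t ∩ {ω | revealState ends W ω = x} ∩ {ω | cluster ends ω w' = y} ∩
          connEvent ends b s) *
        prob p (Qst ends s t ∩ {ω | revealState ends W ω = x} ∩ {ω | cluster ends ω w' = y} ∩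
          connEvent ends o s) /
      prob p (Qst ends s t ∩ {ω | revealState ends W ω = x} ∩ {ω | cluster ends ω w' = y}) =
      pa * (prob q (Qst ends s t ∩ {ω | cluster ends ω w' = y} ∩ connEvent ends b s) *
        prob q (Qst ends s t ∩ {ω | cluster ends ω w' = y} ∩ connEvent ends o s) /
        prob q (Qst ends s t ∩ {ω | cluster ends ω w' = y})) := by
    intro y
    obtain ⟨e1, e2, e3, -, -, -⟩ := hole_event_eq_same ends W o b s t w' x hs hb ho hw y
    show prob p (Qst ends s t ∩ atom ends W x ∩ {ω | cluster ends ω w' = y} ∩ connEvent ends b s) *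
        prob p (Qst ends s t ∩ atom ends W x ∩ {ω | cluster ends ω w' = y} ∩ connEvent ends o s) /
      prob p (Qst ends s t ∩ atom ends W x ∩ {ω | cluster ends ω w' = y}) = _
    rw [e1, e2, e3, prob_atom_inter_del, prob_atom_inter_del, prob_atom_inter_del]
    exact mul_mul_div_mul pa _ _ _
  obtain ⟨-, -, -, e4, e5, e6⟩ := hole_event_eq_same ends W o b s t w' x hs hb ho hw ∅
  have hrhs : prob p (Qst ends s t ∩ {ω | revealState ends W ω = x} ∩ connEvent ends b s) *
        prob p (Qst ends s t ∩ {ω | revealState ends W ω = x} ∩ connEvent ends o s) /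
      prob p (Qst ends s t ∩ {ω | revealState ends W ω = x}) =
      pa * (prob q (Qst ends s t ∩ connEvent ends b s) * prob q (Qst ends s t ∩ connEvent ends o s) /
        prob q (Qst ends s t)) := by
    show prob p (Qst ends s t ∩ atom ends W x ∩ connEvent ends b s) *
        prob p (Qst ends s t ∩ atom ends W x ∩ connEvent ends o s) /
      prob p (Qst ends s t ∩ atom ends W x) = _
    rw [e4, e5, e6, prob_atom_inter_del, prob_atom_inter_del, prob_atom_inter_del]
    exact mul_mul_div_mul pa _ _ _
  simp_rw [hterm]
  rw [hrhs, ← Finset.mul_sum]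
  exact mul_le_mul_of_nonneg_left hRB hA0

/-- **`RBsameOn` from row 2′RB (same form) at every weight vector of the graph**. -/
theorem RBsameOn_of_RBsame_all (hp : IsProbVec p)
    (hRB : ∀ q : E → R, IsProbVec q → RBsame q ends o b s t w') :
    RBsameOn p ends s t (revealState ends W) (fun ω => cluster ends ω w') (connEvent ends b s)
      (connEvent ends o s) := by
  intro x
  change atomRHS p ends s t (revealState ends W) (connEvent ends b s) (connEvent ends o s) x ≤
    atomLHS p ends s t (revealState ends W) (fun ω => cluster ends ω w') (connEvent ends b s)
      (connEvent ends o s) x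
  by_cases hsH : ∃ w : ↥W, s ∈ x w
  · obtain ⟨w, hw⟩ := hsH
    by_cases hb : b ∈ x w
    · refine atomEq_of_subset_X p ends s t hp _ _ _ _ x ?_
      rintro ω ⟨_, hω⟩
      show Conn ends ω b s
      have h := cluster_eq_of_mem_atom ends W hω hw
      rw [← h] at hb
      exact conn_symm hb
    · refine atomEq_of_disjoint_X p ends s t _ _ _ _ x ?_
      rw [Set.eq_empty_iff_forall_notMem]
      rintro ω ⟨⟨_, hω⟩, hX⟩
      have h := cluster_eq_of_mem_atom ends W hω hw
      apply hb
      rw [← h]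
      exact conn_symm hX
  · by_cases hbH : ∃ w : ↥W, b ∈ x w
    · obtain ⟨w, hw⟩ := hbH
      refine atomEq_of_disjoint_X p ends s t _ _ _ _ x ?_
      rw [Set.eq_empty_iff_forall_notMem]
      rintro ω ⟨⟨_, hω⟩, hX⟩
      have h := cluster_eq_of_mem_atom ends W hω hw
      exact hsH ⟨w, by rw [← h]; exact hX⟩
    · by_cases hoH : ∃ w : ↥W, o ∈ x w
      · obtain ⟨w, hw⟩ := hoH
        refine atomEq_of_disjoint_Y p ends s t _ _ _ _ x ?_
        rw [Set.eq_empty_iff_forall_notMem]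
        rintro ω ⟨⟨_, hω⟩, hY⟩
        have h := cluster_eq_of_mem_atom ends W hω hw
        exact hsH ⟨w, by rw [← h]; exact hY⟩
      · by_cases hwH : ∃ w : ↥W, w' ∈ x w
        · obtain ⟨w, hw⟩ := hwH
          refine atomEq_of_const_τ p ends s t _ _ _ _ x (x w) ?_
          rintro ω ⟨_, hω⟩
          exact cluster_eq_of_mem_atom ends W hω hw
        · have hs' : s ∉ revHull W x := fun h => hsH (Set.mem_iUnion.1 h)
          have hb' : b ∉ revHull W x := fun h => hbH (Set.mem_iUnion.1 h)
          have ho' : o ∉ revHull W x := fun h => hoH (Set.mem_iUnion.1 h)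
          have hw' : w' ∉ revHull W x := fun h => hwH (Set.mem_iUnion.1 h)
          exact atom_step_same_of_RBsame p ends W o b s t w' x hp hs' hb' ho' hw'
            (hRB _ (isProbVec_pinSet p ends _ hp))

/-- **The same-cluster chain from row 2′RB**: with `RB_all`, `Cov_{𝓖_{W ∪ {w′}}} ≥ Cov_{𝓖_W}` for
`X = {b ↔ s}`, `Y = {o ↔ s}` (cleared by `P(Q)`). -/
theorem covRevealed_le_insert_of_RB_all {V E : Type} [Fintype V] [DecidableEq V] [Fintype E]
    [DecidableEq E] (hall : RB_all R) (ends : E → Sym2 V) {p : E → R} (hp : IsProbVec p)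
    (o b s t : V) (hst : s ≠ t) (W : Finset V) {w' : V} (hw : w' ∉ W) :
    covRevealed p ends s t W (connEvent ends b s) (connEvent ends o s) ≤
      covRevealed p ends s t (insert w' W) (connEvent ends b s) (connEvent ends o s) :=
  covRevealed_le_insert p ends s t W hw _ _
    (RBsameOn_of_RBsame_all p ends W o b s t w' hp
      (fun q hq => (hall V E ends q hq o b s t w' hst).2))

end Same

end RB

end Summit.Ventures.PercRepro2
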